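import Literature.NumberTheory.Automorphic.AutomorphicTwistSatake
import Literature.NumberTheory.Automorphic.LocalComponentBJProofs
import Literature.LinearAlgebra.Matrix.SmithNormalFormValuationRing
import HarnessLib

/-!
# A cuspidal `π` unramified at `v` is not fixed by the twist by a character ramified at `v`

Topic `NumberTheory/Automorphic`; proof file (theorems only: no definition, no named fact, no
instance).  The criterion by which Chenevier–Harris (Camb. J. Math. 1 (2013), proof of Prop. 3.1.1,
p. 64: "each `F_i/F` is ramified at at least one finite place not in `S` at which `Π` is unramified.
This last condition ensures that `Π_i` is cuspidal") and Harris–Taylor (proof of Thm. VII.1.9) feed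
Arthur–Clozel's Thm. 4.2 (a) ("`π` cuspidal, `π ≇ π ⊗ η`"): **if the cuspidal automorphic
representation `π` of `GL_n(𝔸_F)`, `n ≥ 1`, has a non-zero vector fixed by a level `K(𝔫)` with
`v ∤ 𝔫` (so `π_v` is spherical) and the Hecke character `χ` is RAMIFIED at `v`, then `π ⊗ χ ≠ π`**
(`CuspidalAutomorphicRepGL.twistByChar_ne_of_mem_fixedVectors_of_not_isUnramifiedAt`), in the tree's
`L²` model (`CuspidalAutomorphicRepGL`, twists `twistByChar` of `AutomorphicTwist`).

Printed argument (local, e.g. via the Bernstein–Zelevinsky classification: a spherical irreducible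
`π_v` twisted by a ramified character has no `GL_n(𝒪_v)`-fixed vector).  The tree has no local
representation theory of `GL_n(F_v)`; the proof given here is global-elementary and uses only the
Cartan decomposition `GL_n(F_v) = K_v T(F_v) K_v` (`ValuationSubring.exists_sl_mul_diagonal_mul_sl`),
the unitarity of the regular representation and topological irreducibility:

* if `π ⊗ χ = π` then with the spherical `f₀ ∈ π^{K(𝔫)}` also `f₁ = (χ ∘ det) · f₀ ∈ π`, on which
  `K_v = GL_n(𝒪_v)` acts through the character `χ_v⁻¹ ∘ det`;
* the matrix coefficient `g ↦ ⟪f₀, R(g) f₁⟫` vanishes identically: writing `g_v = k₁ a k₂`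
  (`a` diagonal) and `g = ι_v(g_v) c` with `c_v = 1`, unitarity removes `k₁`, and a torus element
  `t = diag(u, 1, …, 1) ∈ K_v` with `χ_v(u) ≠ 1` commutes with `a`, fixes `f₀` and multiplies
  `R(ι_v(k₂) c) f₁` by `χ_v(u)⁻¹` (its conjugate `k₂⁻¹ t k₂ ∈ K_v` has the same determinant and
  commutes with `c`), so the coefficient equals `χ_v(u)⁻¹` times itself;
* the vectors `x ∈ π` with `⟪f₀, R(g) x⟫ = 0` for all `g` form a closed invariant subspace not
  containing `f₀ ≠ 0`, hence zero by irreducibility; but it contains `f₁`, of norm `‖f₀‖ ≠ 0`.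

## Main statements

* `GLn.exists_kak` — the Cartan decomposition of `GL_n(F_v)` in the tree's vocabulary;
  `GLn.exists_torusElt` — `diag(u, 1, …, 1) ∈ K_v` of determinant `u`;
* `inner_rightRegular_eq_zero_of_torus` — vanishing of the coefficient `⟪f₀, R(g) f₁⟫`;
* `CuspidalAutomorphicRepGL.twistByChar_ne_of_mem_fixedVectors_of_not_isUnramifiedAt` — the
  criterion; `CuspidalAutomorphicRepGL.twistByChar_ne_of_hasSatakeParameterAt_of_not_isUnramifiedAt`
  — the same from an `L²` Satake parameter at `v`.

## References

* G. Chenevier, M. Harris, *Construction of automorphic Galois representations, II*, Camb. J.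
  Math. 1 (2013), proof of Prop. 3.1.1 (p. 64). [ChenevierHarris2013]
* J. Arthur, L. Clozel, *Simple algebras, base change, and the advanced theory of the trace
  formula*, Ann. of Math. Stud. 120 (1989), Ch. 3, Thm. 4.2 (a). [ArthurClozelAMS120]
* D. Mumford, J. Fogarty, F. Kirwan, *Geometric Invariant Theory*, Ch. 2 §1 (Iwahori's
  decomposition `G(K) = G(O) T(K) G(O)`). [folklore]
-/

noncomputable section

open scoped MatrixGroups InnerProductSpace
open NumberField IsDedekindDomain MeasureTheory

namespace Literature.NumberTheory.Automorphic

open AdelicGroupData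
open Literature.NumberTheory.GaloisRepresentations (HeckeCharacter localUnits)

/-! ### Local group theory at `v`: `GL_n(𝒪_v)` inside `K_v`, a torus element, Cartan -/

section Local

variable {n : ℕ} {K : Type} [Field K] [NumberField K] (v : HeightOneSpectrum (𝓞 K))

/-- **Cartan decomposition of `GL_n(F_v)` in the tree's vocabulary**: every `g ∈ GL_n(F_v)` is
`k₁ a k₂` with `k₁, k₂ ∈ K_v = GL_n(𝒪_v)` and `a` diagonal (`ValuationSubring.exists_sl_mul_diagonal_mul_sl`
for the valuation ring `𝒪_v ⊆ F_v`, and `GL_n(𝒪_v) → K_v`, `GLn.map_subtype_mem_valuedCongruenceSubgroup_one`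
of `LocalComponentBJProofs`; Iwahori, Mumford–Fogarty–Kirwan Ch. 2 §1). [folklore] -/
theorem GLn.exists_kak (g : GL (Fin n) (v.adicCompletion K)) :
    ∃ k₁ ∈ valuedCongruenceSubgroup (Fin n) (1 : WithZero (Multiplicative ℤ)),
    ∃ k₂ ∈ valuedCongruenceSubgroup (Fin n) (1 : WithZero (Multiplicative ℤ)),
    ∃ a : GL (Fin n) (v.adicCompletion K),
      (∃ d : Fin n → v.adicCompletion K,
        ((a : GL (Fin n) (v.adicCompletion K)) : Matrix (Fin n) (Fin n) (v.adicCompletion K)) =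
          Matrix.diagonal d) ∧ g = k₁ * a * k₂ := by
  classical
  obtain ⟨P, Q, d, hP, hQ, hg⟩ := (v.adicCompletionIntegers K).exists_sl_mul_diagonal_mul_sl
    (g : Matrix (Fin n) (Fin n) (v.adicCompletion K))
  obtain ⟨k₁, hk₁⟩ : ∃ k₁ : GL (Fin n) (v.adicCompletion K),
      k₁ = Matrix.GeneralLinearGroup.map (v.adicCompletionIntegers K).subtype
        (Matrix.SpecialLinearGroup.toGL ⟨P, hP⟩) := ⟨_, rfl⟩
  obtain ⟨k₂, hk₂⟩ : ∃ k₂ : GL (Fin n) (v.adicCompletion K),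
      k₂ = Matrix.GeneralLinearGroup.map (v.adicCompletionIntegers K).subtype
        (Matrix.SpecialLinearGroup.toGL ⟨Q, hQ⟩) := ⟨_, rfl⟩
  have hPmap : ((k₁ : GL (Fin n) (v.adicCompletion K)) : Matrix (Fin n) (Fin n) (v.adicCompletion K)) =
      P.map (v.adicCompletionIntegers K).subtype := by
    ext i j
    rw [hk₁, Matrix.GeneralLinearGroup.map_apply, Matrix.map_apply]
    rfl
  have hQmap : ((k₂ : GL (Fin n) (v.adicCompletion K)) : Matrix (Fin n) (Fin n) (v.adicCompletion K)) =
      Q.map (v.adicCompletionIntegers K).subtype := by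
    ext i j
    rw [hk₂, Matrix.GeneralLinearGroup.map_apply, Matrix.map_apply]
    rfl
  refine ⟨k₁, hk₁ ▸ GLn.map_subtype_mem_valuedCongruenceSubgroup_one n K v _,
    k₂, hk₂ ▸ GLn.map_subtype_mem_valuedCongruenceSubgroup_one n K v _, k₁⁻¹ * g * k₂⁻¹, ⟨d, ?_⟩, by group⟩
  have h1 : ((k₁⁻¹ : GL (Fin n) (v.adicCompletion K)) : Matrix (Fin n) (Fin n) (v.adicCompletion K)) *
      P.map (v.adicCompletionIntegers K).subtype = 1 := by
    rw [← hPmap, ← Matrix.GeneralLinearGroup.coe_mul, inv_mul_cancel, Matrix.GeneralLinearGroup.coe_one]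
  have h2 : Q.map (v.adicCompletionIntegers K).subtype *
      ((k₂⁻¹ : GL (Fin n) (v.adicCompletion K)) : Matrix (Fin n) (Fin n) (v.adicCompletion K)) = 1 := by
    rw [← hQmap, ← Matrix.GeneralLinearGroup.coe_mul, mul_inv_cancel, Matrix.GeneralLinearGroup.coe_one]
  calc ((k₁⁻¹ * g * k₂⁻¹ : GL (Fin n) (v.adicCompletion K)) : Matrix (Fin n) (Fin n) (v.adicCompletion K))
      = ((k₁⁻¹ : GL (Fin n) (v.adicCompletion K)) : Matrix (Fin n) (Fin n) (v.adicCompletion K)) *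
          (P.map (v.adicCompletionIntegers K).subtype * Matrix.diagonal d *
            Q.map (v.adicCompletionIntegers K).subtype) *
          ((k₂⁻¹ : GL (Fin n) (v.adicCompletion K)) : Matrix (Fin n) (Fin n) (v.adicCompletion K)) := by
        rw [Matrix.GeneralLinearGroup.coe_mul, Matrix.GeneralLinearGroup.coe_mul, ← hg]
    _ = ((k₁⁻¹ : GL (Fin n) (v.adicCompletion K)) : Matrix (Fin n) (Fin n) (v.adicCompletion K)) *
          P.map (v.adicCompletionIntegers K).subtype * Matrix.diagonal d *
          (Q.map (v.adicCompletionIntegers K).subtype *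
            ((k₂⁻¹ : GL (Fin n) (v.adicCompletion K)) : Matrix (Fin n) (Fin n) (v.adicCompletion K))) := by
        simp only [Matrix.mul_assoc]
    _ = Matrix.diagonal d := by rw [h1, h2, Matrix.one_mul, Matrix.mul_one]

/-- **A torus element detecting ramification**: for `n ≥ 1` and a unit `u ∈ 𝒪_vˣ`, the diagonal
matrix `t = diag(u, 1, …, 1)` lies in `K_v = GL_n(𝒪_v)`, is diagonal, and has determinant `u`. [folklore] -/
theorem GLn.exists_torusElt (hn : 0 < n) (u : (v.adicCompletionIntegers K)ˣ) :
    ∃ t ∈ valuedCongruenceSubgroup (Fin n) (1 : WithZero (Multiplicative ℤ)),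
      (∃ e : Fin n → v.adicCompletion K,
        ((t : GL (Fin n) (v.adicCompletion K)) : Matrix (Fin n) (Fin n) (v.adicCompletion K)) =
          Matrix.diagonal e) ∧
      Matrix.GeneralLinearGroup.det t =
        Units.map ((v.adicCompletionIntegers K).subtype : _ →* _) u := by
  set u' : (v.adicCompletion K)ˣ := Units.map ((v.adicCompletionIntegers K).subtype : _ →* _) u
    with hu'
  set d : Fin n → (v.adicCompletion K)ˣ := fun k => if k = ⟨0, hn⟩ then u' else 1 with hd
  refine ⟨glDiagonal n (v.adicCompletion K) d, ?_, ⟨fun k => (d k : v.adicCompletion K),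
    coe_glDiagonal n _ d⟩, ?_⟩
  · refine glDiagonal_mem_valuedCongruenceSubgroup_one (fun k => ?_) fun k => ?_
    · by_cases hk : k = ⟨0, hn⟩
      · rw [hd]; dsimp only; rw [if_pos hk]; exact u.1.2
      · rw [hd]; dsimp only; rw [if_neg hk, Units.val_one, map_one]
    · by_cases hk : k = ⟨0, hn⟩
      · rw [hd]; dsimp only; rw [if_pos hk]; exact u⁻¹.1.2
      · rw [hd]; dsimp only; rw [if_neg hk, inv_one, Units.val_one, map_one]
  · rw [det_glDiagonal, Fintype.prod_ite_eq']

end Local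

/-! ### The vanishing matrix coefficient and the criterion -/

section Global

variable {n : ℕ} {F : Type} [Field F] [NumberField F]
  {μ : Measure (gl n F).automorphicQuotient} [(gl n F).IsAutomorphicMeasure μ]

/-- **Vanishing of the matrix coefficient `⟪f₀, R(g) f₁⟫`.**  Let `R` be the regular
representation of `GL_n(𝔸_F)` on `L²(GL_n(𝔸_F) ⧸ A_G GL_n(F))`, `v` a finite place, `f₀ ∈ L²`
fixed by `ι_v(K_v)`, `K_v = GL_n(𝒪_v)`, and `f₁ ∈ L²` a vector on which `ι_v(K_v)` acts through
`k ↦ (χ(det ι_v(k)))⁻¹` for a Hecke character `χ`; suppose some `t ∈ K_v`, diagonal, has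
`χ((det t)_v) ≠ 1`.  Then `⟪f₀, R(g) f₁⟫ = 0` for every `g ∈ GL_n(𝔸_F)`: write `g = ι_v(g_v) c`
with `c_v = 1` and `g_v = k₁ a k₂` (Cartan, `GLn.exists_kak`); unitarity removes `k₁`; `t`
commutes with `a`, fixes `f₀`, and `ι_v(t) ι_v(k₂) c = ι_v(k₂) c ι_v(k₂⁻¹ t k₂)`
(`GLn.ofLocal_mul_eq_mul_ofLocal_of_toLocal_eq_one`) with `det (k₂⁻¹ t k₂) = det t`, so the
coefficient is `(χ((det t)_v))⁻¹` times itself. [folklore] -/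
theorem inner_rightRegular_eq_zero_of_torus {v : HeightOneSpectrum (𝓞 F)} (χ : HeckeCharacter F)
    {f₀ f₁ : (gl n F).L2 μ}
    (hf₀ : ∀ k ∈ valuedCongruenceSubgroup (Fin n) (1 : WithZero (Multiplicative ℤ)),
      (gl n F).rightRegular μ (GLn.ofLocal n F v k) f₀ = f₀)
    (hf₁ : ∀ k ∈ valuedCongruenceSubgroup (Fin n) (1 : WithZero (Multiplicative ℤ)),
      (gl n F).rightRegular μ (GLn.ofLocal n F v k) f₁ =
        ((χ (localUnits v (Matrix.GeneralLinearGroup.det k)) : ℂˣ) : ℂ)⁻¹ • f₁)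
    {t : GL (Fin n) (v.adicCompletion F)}
    (ht : t ∈ valuedCongruenceSubgroup (Fin n) (1 : WithZero (Multiplicative ℤ)))
    (htdiag : ∃ e : Fin n → v.adicCompletion F,
      ((t : GL (Fin n) (v.adicCompletion F)) : Matrix (Fin n) (Fin n) (v.adicCompletion F)) =
        Matrix.diagonal e)
    (hχt : ((χ (localUnits v (Matrix.GeneralLinearGroup.det t)) : ℂˣ) : ℂ) ≠ 1)
    (g : (gl n F).Adelic) :
    ⟪f₀, (gl n F).rightRegular μ g f₁⟫_ℂ = 0 := by
  classical
  -- everything is typed on `(gl n F).Adelic = GL_n(𝔸_F)` (typing rule of `AutomorphicRepsGLSatakeFlathProofs`)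
  let ι : GL (Fin n) (v.adicCompletion F) →* (gl n F).Adelic := GLn.ofLocal n F v
  let Kv : Subgroup (GL (Fin n) (v.adicCompletion F)) :=
    valuedCongruenceSubgroup (Fin n) (1 : WithZero (Multiplicative ℤ))
  have hU : ((gl n F).rightRegular μ).IsUnitary := (gl n F).isUnitary_rightRegular μ
  have hf₀' : ∀ k ∈ Kv, (gl n F).rightRegular μ (ι k) f₀ = f₀ := fun k hk => hf₀ k hk
  have hf₁' : ∀ k ∈ Kv, (gl n F).rightRegular μ (ι k) f₁ =
      ((χ (localUnits v (Matrix.GeneralLinearGroup.det k)) : ℂˣ) : ℂ)⁻¹ • f₁ := fun k hk => hf₁ k hk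
  have hπι : ∀ y, (gl n F).toLocal v (ι y) = y := fun y => GLn.toLocal_ofLocal y
  have hC : ∀ c : (gl n F).Adelic, (gl n F).toLocal v c = 1 → ∀ s, ι s * c = c * ι s :=
    fun c hc s => GLn.ofLocal_mul_eq_mul_ofLocal_of_toLocal_eq_one s hc
  -- removing a `K_v`-element on the left: `⟪f₀, R(ι k) X⟫ = ⟪f₀, X⟫`
  have hleft : ∀ k ∈ Kv, ∀ X : (gl n F).L2 μ,
      ⟪f₀, (gl n F).rightRegular μ (ι k) X⟫_ℂ = ⟪f₀, X⟫_ℂ := by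
    intro k hk X
    have h := hU.inner_map_map (ι k) ((gl n F).rightRegular μ (ι k⁻¹) f₀) X
    rw [← mul_apply_eq_comp, ← map_mul, ← map_mul, mul_inv_cancel, map_one, map_one,
      one_apply_eq_self] at h
    rw [h, hf₀' k⁻¹ (inv_mem hk)]
  -- decomposition `g = ι(g_v) c`, `c_v = 1`
  obtain ⟨gv, c, hcv, hgc⟩ : ∃ (gv : GL (Fin n) (v.adicCompletion F)) (c : (gl n F).Adelic),
      (gl n F).toLocal v c = 1 ∧ g = ι gv * c := by
    refine ⟨(gl n F).toLocal v g, (ι ((gl n F).toLocal v g))⁻¹ * g, ?_, by rw [mul_inv_cancel_left]⟩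
    rw [map_mul, map_inv, hπι, inv_mul_cancel]
  -- Cartan `g_v = k₁ a k₂`
  obtain ⟨k₁, hk₁, k₂, hk₂, a, ⟨d, hd⟩, hgva⟩ := GLn.exists_kak v gv
  obtain ⟨e, he⟩ := htdiag
  -- the commutations: `t a = a t`; `t k₂ = k₂ t'` with `t' = k₂⁻¹ t k₂ ∈ K_v`, `det t' = det t`
  have hta : ι t * ι a = ι a * ι t := by
    rw [← map_mul, ← map_mul]
    congr 1
    refine Units.ext ?_
    rw [Units.val_mul, Units.val_mul, he, hd, Matrix.diagonal_mul_diagonal,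
      Matrix.diagonal_mul_diagonal]
    congr 1
    funext i
    exact mul_comm _ _
  obtain ⟨t', ht'def⟩ : ∃ t' : GL (Fin n) (v.adicCompletion F), t' = k₂⁻¹ * t * k₂ := ⟨_, rfl⟩
  have ht'mem : t' ∈ Kv := by
    rw [ht'def]
    exact mul_mem (mul_mem (inv_mem hk₂) ht) hk₂
  have hdet' : Matrix.GeneralLinearGroup.det t' = Matrix.GeneralLinearGroup.det t := by
    rw [ht'def, map_mul, map_mul, map_inv, mul_right_comm, inv_mul_cancel, one_mul]
  have hkt' : k₂ * t' = t * k₂ := by rw [ht'def, ← mul_assoc, mul_inv_cancel_left]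
  have htk : ι t * ι k₂ * c = ι k₂ * c * ι t' := by
    rw [mul_assoc (ι k₂), ← hC c hcv t', ← mul_assoc, ← map_mul, ← map_mul, hkt']
  -- the coefficient as `⟪f₀, R(ι a) W⟫`, `W = R(ι(k₂) c) f₁`
  obtain ⟨W, hW⟩ : ∃ W : (gl n F).L2 μ, W = (gl n F).rightRegular μ (ι k₂ * c) f₁ := ⟨_, rfl⟩
  have hg' : g = ι k₁ * (ι a * (ι k₂ * c)) := by
    rw [hgc, hgva, map_mul, map_mul, mul_assoc, mul_assoc]
  have hstep1 : ⟪f₀, (gl n F).rightRegular μ g f₁⟫_ℂ = ⟪f₀, (gl n F).rightRegular μ (ι a) W⟫_ℂ := by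
    rw [hg', map_mul, mul_apply_eq_comp, hleft k₁ hk₁, map_mul, mul_apply_eq_comp, hW]
  -- `R(ι t) W = z⁻¹ • W`
  have hRtW : (gl n F).rightRegular μ (ι t) W =
      ((χ (localUnits v (Matrix.GeneralLinearGroup.det t)) : ℂˣ) : ℂ)⁻¹ • W := by
    rw [hW, ← mul_apply_eq_comp, ← map_mul, ← mul_assoc, htk, map_mul, mul_apply_eq_comp,
      hf₁' t' ht'mem, hdet', map_smul]
  -- `V = z⁻¹ V`, hence `V = 0`
  have hV : ⟪f₀, (gl n F).rightRegular μ (ι a) W⟫_ℂ =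
      ((χ (localUnits v (Matrix.GeneralLinearGroup.det t)) : ℂˣ) : ℂ)⁻¹ *
        ⟪f₀, (gl n F).rightRegular μ (ι a) W⟫_ℂ := by
    calc ⟪f₀, (gl n F).rightRegular μ (ι a) W⟫_ℂ
        = ⟪(gl n F).rightRegular μ (ι t) f₀,
            (gl n F).rightRegular μ (ι t) ((gl n F).rightRegular μ (ι a) W)⟫_ℂ :=
          (hU.inner_map_map _ _ _).symm
      _ = ⟪f₀, (gl n F).rightRegular μ (ι a) ((gl n F).rightRegular μ (ι t) W)⟫_ℂ := by
          rw [hf₀' t ht, ← mul_apply_eq_comp, ← map_mul, hta, map_mul, mul_apply_eq_comp]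
      _ = ((χ (localUnits v (Matrix.GeneralLinearGroup.det t)) : ℂˣ) : ℂ)⁻¹ *
            ⟪f₀, (gl n F).rightRegular μ (ι a) W⟫_ℂ := by
          rw [hRtW, map_smul, inner_smul_right]
  have hz1 : ((χ (localUnits v (Matrix.GeneralLinearGroup.det t)) : ℂˣ) : ℂ)⁻¹ ≠ 1 :=
    fun h => hχt (inv_eq_one.mp h)
  have hzero : (1 - ((χ (localUnits v (Matrix.GeneralLinearGroup.det t)) : ℂˣ) : ℂ)⁻¹) *
      ⟪f₀, (gl n F).rightRegular μ (ι a) W⟫_ℂ = 0 := by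
    rw [sub_mul, one_mul, ← hV, sub_self]
  rw [hstep1]
  exact (mul_eq_zero.mp hzero).resolve_left (sub_ne_zero.mpr (Ne.symm hz1))

/-- **A cuspidal `π` with a spherical vector at `v` is not fixed by the twist by a character
ramified at `v`** (the criterion of Chenevier–Harris, proof of Prop. 3.1.1, p. 64, for the
hypothesis "`π ≇ π ⊗ η`" of Arthur–Clozel's Thm. 4.2 (a)).  Let `π ≤ L²_cusp(GL_n(𝔸_F) ⧸ A_G GL_n(F))`
be cuspidal (closed, irreducible), `n ≥ 1`, with a non-zero vector `f₀` fixed by the principal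
congruence subgroup `K(𝔫)`, `𝔫 ≠ 0`, `v ∤ 𝔫`, and let `χ` be a unitary Hecke character, trivial on
`ℝ_{>0}`, RAMIFIED at `v`.  Then `π ⊗ χ ≠ π`.  Proof: if `π ⊗ χ = π` then `f₁ = (χ ∘ det) f₀ ∈ π`,
on which `ι_v(K_v)` acts by `(χ_v ∘ det)⁻¹` (`rightRegular_mulL2`); by
`inner_rightRegular_eq_zero_of_torus` (torus element `diag(u,1,…,1)`, `χ_v(u) ≠ 1`) the closed
invariant subspace `{x ∈ π | ∀ g, ⟪f₀, R(g) x⟫ = 0}` contains `f₁`; it misses `f₀ ≠ 0`, so it is `0`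
by irreducibility — but `‖f₁‖ = ‖f₀‖ ≠ 0`.  (For `n = 0` the statement is false: every twist of
the trivial group's representation is trivial.)
[cite: ChenevierHarris2013, proof of Prop. 3.1.1 (p. 64)] -/
theorem CuspidalAutomorphicRepGL.twistByChar_ne_of_mem_fixedVectors_of_not_isUnramifiedAt
    (hn : 0 < n) (P : CuspidalAutomorphicRepGL n F μ) (χ : HeckeCharacter F) (hχ : χ.IsUnitary)
    (hχ₀ : ∀ t, χ (posRealIdele F t) = 1) {𝔫 : Ideal (𝓞 F)} (h𝔫 : 𝔫 ≠ 0)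
    {v : HeightOneSpectrum (𝓞 F)} (hv : ¬ v.asIdeal ∣ 𝔫)
    {f₀ : P.1.toSubmodule} (hf₀ : f₀ ∈ P.1.fixedVectors (principalCongruenceLevel n F 𝔫))
    (hf₀0 : f₀ ≠ 0) (hram : ¬ χ.IsUnramifiedAt v) :
    P.twistByChar χ hχ hχ₀ ≠ P := by
  classical
  intro heq
  -- a unit `u` with `χ_v(u) ≠ 1`, and the torus element
  obtain ⟨u, hu⟩ : ∃ u : (v.adicCompletionIntegers F)ˣ,
      χ.localComponent v (Units.map ((v.adicCompletionIntegers F).subtype : _ →* _) u) ≠ 1 :=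
    not_forall.mp hram
  obtain ⟨t, ht, htdiag, hdet⟩ := GLn.exists_torusElt v hn u
  have hχt : ((χ (localUnits v (Matrix.GeneralLinearGroup.det t)) : ℂˣ) : ℂ) ≠ 1 := by
    rw [hdet, ← HeckeCharacter.localComponent_apply]
    exact fun h => hu (Units.ext h)
  -- `f₁ = ψ̄ f₀ ∈ π`, `ψ = χ ∘ det`
  have hf₁ : (detChar χ hχ hχ₀).mulL2 μ (f₀ : (gl n F).L2 μ) ∈ P.1 := by
    have h0 : (f₀ : (gl n F).L2 μ) ∈ (P.twistByChar χ hχ hχ₀).1 := by rw [heq]; exact f₀.2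
    rw [CuspidalAutomorphicRepGL.twistByChar_val, ContRepresentation.ClosedSubrep.mem_twist_iff,
      AutomorphicCharacter.inv_inv] at h0
    exact h0
  -- `K_v` fixes `f₀` and acts on `f₁` through `(χ_v ∘ det)⁻¹`
  have hfix : ∀ k ∈ valuedCongruenceSubgroup (Fin n) (1 : WithZero (Multiplicative ℤ)),
      (gl n F).rightRegular μ (GLn.ofLocal n F v k) (f₀ : (gl n F).L2 μ) = f₀ := by
    intro k hk
    have hmem : GLn.ofLocal n F v k ∈ principalCongruenceLevel n F 𝔫 :=
      isMaximalAt_principalCongruenceLevel n F v h𝔫 hv ⟨k, hk, rfl⟩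
    have := (P.1.mem_fixedVectors _ f₀).1 hf₀ _ hmem
    rw [Subtype.ext_iff, ContRepresentation.ClosedSubrep.coe_toContRep_apply] at this
    exact this
  have heig : ∀ k ∈ valuedCongruenceSubgroup (Fin n) (1 : WithZero (Multiplicative ℤ)),
      (gl n F).rightRegular μ (GLn.ofLocal n F v k) ((detChar χ hχ hχ₀).mulL2 μ (f₀ : (gl n F).L2 μ)) =
      ((χ (localUnits v (Matrix.GeneralLinearGroup.det k)) : ℂˣ) : ℂ)⁻¹ •
        (detChar χ hχ hχ₀).mulL2 μ (f₀ : (gl n F).L2 μ) := by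
    intro k hk
    rw [AutomorphicCharacter.rightRegular_mulL2, hfix k hk, detChar_apply, GLn.det_ofLocal]
  -- the vanishing coefficient
  have hcoef : ∀ g : (gl n F).Adelic,
      ⟪(f₀ : (gl n F).L2 μ),
        (gl n F).rightRegular μ g ((detChar χ hχ hχ₀).mulL2 μ (f₀ : (gl n F).L2 μ))⟫_ℂ = 0 :=
    inner_rightRegular_eq_zero_of_torus χ hfix heig ht htdiag hχt
  -- the closed invariant subspace `S = {x ∈ π | ∀ g, ⟪f₀, R g x⟫ = 0}` of `π`
  let S : ContRepresentation.ClosedSubrep P.1.toContRep :=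
    { toSubmodule :=
        { carrier := {x | ∀ g : (gl n F).Adelic,
            ⟪(f₀ : (gl n F).L2 μ), (gl n F).rightRegular μ g (x : (gl n F).L2 μ)⟫_ℂ = 0}
          add_mem' := fun {x y} hx hy g => by
            rw [Submodule.coe_add, map_add, inner_add_right, hx g, hy g, add_zero]
          zero_mem' := fun g => by rw [Submodule.coe_zero, map_zero, inner_zero_right]
          smul_mem' := fun c x hx g => by
            rw [Submodule.coe_smul, map_smul, inner_smul_right, hx g, mul_zero] }
      apply_mem_toSubmodule := fun g x hx g' => by
        show ⟪(f₀ : (gl n F).L2 μ), (gl n F).rightRegular μ g'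
          ((P.1.toContRep g x : P.1.toSubmodule) : (gl n F).L2 μ)⟫_ℂ = 0
        rw [ContRepresentation.ClosedSubrep.coe_toContRep_apply, ← mul_apply_eq_comp, ← map_mul]
        exact hx _
      isClosed' := by
        show IsClosed {x : P.1.toSubmodule | ∀ g : (gl n F).Adelic,
          ⟪(f₀ : (gl n F).L2 μ), (gl n F).rightRegular μ g (x : (gl n F).L2 μ)⟫_ℂ = 0}
        rw [Set.setOf_forall]
        exact isClosed_iInter fun g => isClosed_eq
          (continuous_const.inner (((gl n F).rightRegular μ g).continuous.comp continuous_subtype_val))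
          continuous_const }
  have hSne : S ≠ ⊤ := by
    intro hS
    have hf₀S : f₀ ∈ S := by rw [hS]; exact ContRepresentation.ClosedSubrep.mem_top _
    have h1 : ⟪(f₀ : (gl n F).L2 μ), (gl n F).rightRegular μ 1 (f₀ : (gl n F).L2 μ)⟫_ℂ = 0 := hf₀S 1
    rw [map_one, one_apply_eq_self, inner_self_eq_zero] at h1
    exact hf₀0 (Subtype.ext h1)
  haveI : IsSimpleOrder (ContRepresentation.ClosedSubrep P.1.toContRep) := P.2.2
  have hSbot : S = ⊥ := (IsSimpleOrder.eq_bot_or_eq_top S).resolve_right hSne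
  have hf₁S : (⟨(detChar χ hχ hχ₀).mulL2 μ (f₀ : (gl n F).L2 μ), hf₁⟩ : P.1.toSubmodule) ∈ S :=
    fun g => hcoef g
  rw [hSbot, ContRepresentation.ClosedSubrep.mem_bot] at hf₁S
  have h0 : (detChar χ hχ hχ₀).mulL2 μ (f₀ : (gl n F).L2 μ) = 0 := congrArg Subtype.val hf₁S
  have hnorm : ‖(f₀ : (gl n F).L2 μ)‖ = 0 := by
    rw [← (detChar χ hχ hχ₀).norm_mulL2 μ (f₀ : (gl n F).L2 μ), h0, norm_zero]
  exact hf₀0 (Subtype.ext (norm_eq_zero.mp hnorm))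

/-- **The criterion from an `L²` Satake parameter**: if the cuspidal `π` on `GL_n(𝔸_F)`, `n ≥ 1`,
has a Satake parameter at `v` with respect to a level `K(𝔫)`, `𝔫 ≠ 0`, `v ∤ 𝔫`
(`HasSatakeParameterAt`, which provides a non-zero `K(𝔫)`-fixed Hecke eigenvector), and `χ` is
ramified at `v`, then `π ⊗ χ ≠ π`. [cite: ChenevierHarris2013, proof of Prop. 3.1.1 (p. 64)] -/
theorem CuspidalAutomorphicRepGL.twistByChar_ne_of_hasSatakeParameterAt_of_not_isUnramifiedAt
    (hn : 0 < n) (P : CuspidalAutomorphicRepGL n F μ) (χ : HeckeCharacter F) (hχ : χ.IsUnitary)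
    (hχ₀ : ∀ t, χ (posRealIdele F t) = 1) {𝔫 : Ideal (𝓞 F)} (h𝔫 : 𝔫 ≠ 0)
    {v : HeightOneSpectrum (𝓞 F)} (hv : ¬ v.asIdeal ∣ 𝔫) {ϖ : (v.adicCompletion F)ˣ}
    {α : Multiset ℂ} (hα : HasSatakeParameterAt P.1 (principalCongruenceLevel n F 𝔫) v ϖ α)
    (hram : ¬ χ.IsUnramifiedAt v) :
    P.twistByChar χ hχ hχ₀ ≠ P := by
  obtain ⟨-, -, f₀, hf₀, hf₀0, -⟩ := hα
  exact P.twistByChar_ne_of_mem_fixedVectors_of_not_isUnramifiedAt hn χ hχ hχ₀ h𝔫 hv hf₀ hf₀0 hram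

end Global

end Literature.NumberTheory.Automorphic
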